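import Mathlib
import Literature.Computability.Complexity.ConstantDepth
import Literature.Computability.Complexity.CircuitRestriction
import Literature.Computability.Complexity.TC0SubsetNC1Reduction
import Summits.QuantumAdvantage.QuantumAdvantage.Theorems.MobiusLadderLiouvilleOrthogonalTC0StubDepthOneLtf
import HarnessLib

/-!
# Crux `MobiusLadder.LiouvilleOrthogonalTC0` (stmt-QuantumAdvantage-1393), line `Sketch`, skeleton v6:
# stub `stub_depthTwo_nf` — the depth-two normal form of `tcBasis` circuits

A circuit over `tcBasis = {¬} ∪ {∧ₖ, ∨ₖ, MAJₖ : k ∈ ℕ}` with `acDepth ≤ 2` (negation gates are free)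
computes, up to a free output negation `b`, either

* an `OR` of `K` integer linear threshold tests `[t_a ≤ Σ_i w_{a,i} x_i]` of the inputs (top gate
  `∨ₖ`; top gate `∧ₖ` by De Morgan, the negation of an integer test being one
  (`DepthOneLtf.ltf_not`); a wire of depth `≤ 1` is a single test), or
* a weighted majority `[θ ≤ 2 Σ_a μ_a [t_a ≤ Σ_i w_{a,i} x_i]]` of `K` such tests (top gate `MAJₖ`,
  i.e. `[k ≤ 2 · #ones]`, its DISTINCT argument wires counted with multiplicity `μ`),

with `K ≤ size + n`: the tests are indexed by the distinct wires of the straight-line program (its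
`size` gates and the `n` inputs, enumerated through `finSumFinEquiv`), not by the unbounded arity of
the top gate; wires the top gate does not read get the constantly false test `[1 ≤ 0]`
(resp. multiplicity `0`).

Proof: a wire invariant (`DepthTwoNf.wire_nf`) proved by reverse induction on the program, on top of
the depth-one invariant `DepthOneLtf.wire_invariant` (every valid wire of `acWeight`-depth `≤ 1`
carries an integer test): the last gate is either `¬` (flip `b`, `DepthTwoNf.nf_not`), or a gate of
weight `1`, all of whose argument wires have depth `≤ 1`, identified through `mem_tcBasis_iff` as
`∧ₖ`, `∨ₖ` or `MAJₖ` (`DepthTwoNf.nf_gate`; the count of true arguments over distinct wires is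
`numOnes_comp_eq_wsum`). The normal form is spelled out in every statement (no auxiliary predicate).
-/

set_option linter.dupNamespace false -- D-0017: single-problem summit ⇒ `QuantumAdvantage.QuantumAdvantage` by design

namespace Summit.QuantumAdvantage.QuantumAdvantage.Theorems.LiouvilleOrthogonalTC0

open Finset
open Literature.Computability.Complexity
open Literature.Computability.Complexity.GateList

namespace DepthTwoNf

variable {n : ℕ}

/-! ### Boolean bookkeeping -/

/-- `false ⊕ d = d`. -/
theorem xor_false_left (d : Bool) : xor false d = d := by cases d <;> rfl

/-- `true ⊕ d = ¬d`. -/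
theorem xor_true_left (d : Bool) : xor true d = !d := by cases d <;> rfl

/-- `¬(b ⊕ d) = (¬b) ⊕ d`: an output negation is absorbed into the free sign `b`. -/
theorem not_xor_eq (b d : Bool) : (!xor b d) = xor (!b) d := by cases b <;> cases d <;> rfl

/-! ### The normal form: closure under negation, single tests -/

/-- The normal form (an `OR` of `K ≤ M` integer tests, or a weighted majority of `K ≤ M` integer
tests, up to a sign `b`) is closed under negation: flip the sign. -/
theorem nf_not {f : (Fin n → Bool) → Bool} {M : ℕ}
    (h : ∃ (K : ℕ) (b : Bool) (w : Fin K → Fin n → ℤ) (t : Fin K → ℤ), K ≤ M ∧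
      ((∀ x : Fin n → Bool, f x = xor b (decide (∃ a : Fin K,
          t a ≤ ∑ i, w a i * (if x i then (1 : ℤ) else 0)))) ∨
       (∃ (μ : Fin K → ℕ) (θ : ℕ), ∀ x : Fin n → Bool, f x = xor b (decide (θ ≤ 2 * ∑ a : Fin K,
          μ a * (decide (t a ≤ ∑ i, w a i * (if x i then (1 : ℤ) else 0))).toNat))))) :
    ∃ (K : ℕ) (b : Bool) (w : Fin K → Fin n → ℤ) (t : Fin K → ℤ), K ≤ M ∧
      ((∀ x : Fin n → Bool, (!f x) = xor b (decide (∃ a : Fin K,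
          t a ≤ ∑ i, w a i * (if x i then (1 : ℤ) else 0)))) ∨
       (∃ (μ : Fin K → ℕ) (θ : ℕ), ∀ x : Fin n → Bool, (!f x) = xor b (decide (θ ≤ 2 * ∑ a : Fin K,
          μ a * (decide (t a ≤ ∑ i, w a i * (if x i then (1 : ℤ) else 0))).toNat)))) := by
  obtain ⟨K, b, w, t, hK, h⟩ := h
  refine ⟨K, !b, w, t, hK, ?_⟩
  rcases h with h | ⟨μ, θ, h⟩
  · exact Or.inl fun x => by rw [h x, not_xor_eq]
  · exact Or.inr ⟨μ, θ, fun x => by rw [h x, not_xor_eq]⟩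

/-- A single integer linear threshold test is in normal form: an `OR` of one test (`1 ≤ M`). -/
theorem nf_of_ltf {f : (Fin n → Bool) → Bool} {M : ℕ} (hM : 1 ≤ M)
    (hf : ∃ (w : Fin n → ℤ) (θ : ℤ), ∀ x : Fin n → Bool,
      f x = decide (θ ≤ ∑ j, w j * (if x j then (1 : ℤ) else 0))) :
    ∃ (K : ℕ) (b : Bool) (w : Fin K → Fin n → ℤ) (t : Fin K → ℤ), K ≤ M ∧
      ((∀ x : Fin n → Bool, f x = xor b (decide (∃ a : Fin K,
          t a ≤ ∑ i, w a i * (if x i then (1 : ℤ) else 0)))) ∨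
       (∃ (μ : Fin K → ℕ) (θ : ℕ), ∀ x : Fin n → Bool, f x = xor b (decide (θ ≤ 2 * ∑ a : Fin K,
          μ a * (decide (t a ≤ ∑ i, w a i * (if x i then (1 : ℤ) else 0))).toNat)))) := by
  obtain ⟨w, θ, hf⟩ := hf
  refine ⟨1, false, fun _ => w, fun _ => θ, hM, Or.inl fun x => ?_⟩
  rw [hf x, xor_false_left, decide_eq_decide]
  exact ⟨fun h => ⟨0, h⟩, fun ⟨_, h⟩ => h⟩

/-! ### Indexing the distinct wires of a program -/

/-- **Indexing the wires.** The valid wires of a program with `s` gates over `n` inputs are covered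
by `Fin (s + n)`: decode the first `s` indices as the gate wires `inr 0, …, inr (s - 1)` and the last
`n` as the input wires `inl i` (through `finSumFinEquiv`). -/
theorem exists_decoder (s n : ℕ) :
    ∃ D : Fin (s + n) → Fin n ⊕ ℕ, ∀ u, OutOK s u → ∃ c, D c = u := by
  refine ⟨fun c => Sum.elim (fun j : Fin s => (Sum.inr (j : ℕ) : Fin n ⊕ ℕ))
    (fun i : Fin n => Sum.inl i) (finSumFinEquiv.symm c), fun u hu => ?_⟩
  cases u with
  | inl i =>
    exact ⟨finSumFinEquiv (Sum.inr i), by simp only [Equiv.symm_apply_apply, Sum.elim_inr]⟩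
  | inr m =>
    exact ⟨finSumFinEquiv (Sum.inl ⟨m, hu m rfl⟩), by
      simp only [Equiv.symm_apply_apply, Sum.elim_inl]⟩

/-- **An `OR` over argument positions is an `OR` over distinct wires.** If every argument wire of a
gate (valid for a program with `s` gates) carries an integer test, then `∃ a, v_{args a}(x)` is the
`OR` of `s + n` integer tests indexed by the wires (a wire that is not read gets the false test
`[1 ≤ 0]`). -/
theorem or_tests {s k : ℕ} (val : (Fin n ⊕ ℕ) → (Fin n → Bool) → Bool) (args : Fin k → Fin n ⊕ ℕ)
    (hargs : ∀ a, OutOK s (args a))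
    (hL : ∀ a, ∃ (w : Fin n → ℤ) (θ : ℤ), ∀ x : Fin n → Bool,
      val (args a) x = decide (θ ≤ ∑ j, w j * (if x j then (1 : ℤ) else 0))) :
    ∃ (w : Fin (s + n) → Fin n → ℤ) (t : Fin (s + n) → ℤ), ∀ x : Fin n → Bool,
      decide (∃ a, val (args a) x = true) =
        decide (∃ c : Fin (s + n), t c ≤ ∑ i, w c i * (if x i then (1 : ℤ) else 0)) := by
  obtain ⟨D, hD⟩ := exists_decoder s n
  choose idx hidx using fun a => hD (args a) (hargs a)
  have htest : ∀ c : Fin (s + n), ∃ (w : Fin n → ℤ) (θ : ℤ), ∀ x : Fin n → Bool,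
      (θ ≤ ∑ j, w j * (if x j then (1 : ℤ) else 0)) ↔ ∃ a, idx a = c ∧ val (args a) x = true := by
    intro c
    by_cases hc : ∃ a, idx a = c
    · obtain ⟨a, rfl⟩ := hc
      obtain ⟨w, θ, hw⟩ := hL a
      refine ⟨w, θ, fun x => ?_⟩
      have key : (θ ≤ ∑ j, w j * (if x j then (1 : ℤ) else 0)) ↔ val (args a) x = true := by
        rw [hw x, decide_eq_true_eq]
      rw [key]
      refine ⟨fun h => ⟨a, rfl, h⟩, ?_⟩
      rintro ⟨a', ha', h'⟩
      have hw' : args a' = args a := by rw [← hidx a', ← hidx a, ha']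
      rwa [hw'] at h'
    · refine ⟨0, 1, fun x => ?_⟩
      have h0 : ¬((1 : ℤ) ≤ ∑ j, (0 : Fin n → ℤ) j * (if x j then (1 : ℤ) else 0)) := by simp
      exact ⟨fun h => absurd h h0, fun ⟨a, ha, _⟩ => absurd ⟨a, ha⟩ hc⟩
  choose w t hwt using htest
  refine ⟨w, t, fun x => ?_⟩
  rw [decide_eq_decide]
  constructor
  · rintro ⟨a, ha⟩
    exact ⟨idx a, (hwt (idx a) x).2 ⟨a, rfl, ha⟩⟩
  · rintro ⟨c, hc⟩
    obtain ⟨a, -, ha⟩ := (hwt c x).1 hc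
    exact ⟨a, ha⟩

/-- **Counting true arguments over distinct wires.** If every argument wire of a gate carries an
integer test, the number of true arguments is `Σ_c μ_c · [test_c(x)]` over the `s + n` wires, with
`μ_c` the number of argument positions reading wire `c` (`numOnes_comp_eq_wsum`). -/
theorem numOnes_tests {s k : ℕ} (val : (Fin n ⊕ ℕ) → (Fin n → Bool) → Bool)
    (args : Fin k → Fin n ⊕ ℕ) (hargs : ∀ a, OutOK s (args a))
    (hL : ∀ a, ∃ (w : Fin n → ℤ) (θ : ℤ), ∀ x : Fin n → Bool,
      val (args a) x = decide (θ ≤ ∑ j, w j * (if x j then (1 : ℤ) else 0))) :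
    ∃ (w : Fin (s + n) → Fin n → ℤ) (t : Fin (s + n) → ℤ) (μ : Fin (s + n) → ℕ),
      ∀ x : Fin n → Bool, GateFn.numOnes (fun a => val (args a) x) =
        ∑ c, μ c * (decide (t c ≤ ∑ i, w c i * (if x i then (1 : ℤ) else 0))).toNat := by
  obtain ⟨D, hD⟩ := exists_decoder s n
  choose idx hidx using fun a => hD (args a) (hargs a)
  have htest : ∀ c : Fin (s + n), ∃ (w : Fin n → ℤ) (θ : ℤ), (∃ a, idx a = c) →
      ∀ x : Fin n → Bool,
        val (D c) x = decide (θ ≤ ∑ j, w j * (if x j then (1 : ℤ) else 0)) := by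
    intro c
    by_cases hc : ∃ a, idx a = c
    · obtain ⟨a, rfl⟩ := hc
      obtain ⟨w, θ, hw⟩ := hL a
      exact ⟨w, θ, fun _ x => by rw [hidx a]; exact hw x⟩
    · exact ⟨0, 0, fun h => absurd h hc⟩
  choose w t hwt using htest
  refine ⟨w, t, fun c => (univ.filter fun a => idx a = c).card, fun x => ?_⟩
  show GateFn.numOnes (fun a => val (args a) x) =
      ∑ c, (univ.filter fun a => idx a = c).card *
        (decide (t c ≤ ∑ i, w c i * (if x i then (1 : ℤ) else 0))).toNat
  have h1 : GateFn.numOnes (fun a => val (args a) x) =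
      ∑ c, (univ.filter fun a => idx a = c).card * (val (D c) x).toNat := by
    rw [← numOnes_comp_eq_wsum idx (fun c => val (D c) x)]
    simp only [hidx]
  rw [h1]
  refine Finset.sum_congr rfl fun c _ => ?_
  by_cases hc : ∃ a, idx a = c
  · rw [hwt c hc x]
  · have h0 : (univ.filter fun a => idx a = c).card = 0 := by
      rw [Finset.card_eq_zero, Finset.filter_eq_empty_iff]
      intro a _ ha
      exact hc ⟨a, ha⟩
    simp only [h0, zero_mul]

/-! ### The gates of `tcBasis` -/

/-- An `∨ₖ` gate computes the disjunction of its arguments. -/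
theorem op_of_fn_eq_or (g : Gate (Fin n)) {k : ℕ} (h : g.fn = GateFn.or k) :
    ∀ v, g.op v = decide (∃ a, v a = true) := by
  obtain ⟨k', op, args⟩ := g
  simp only [Gate.fn, GateFn.or, Sigma.mk.inj_iff] at h
  obtain ⟨rfl, hop⟩ := h
  cases hop
  exact fun v => rfl

/-- An `∧ₖ` gate computes the conjunction of its arguments. -/
theorem op_of_fn_eq_and (g : Gate (Fin n)) {k : ℕ} (h : g.fn = GateFn.and k) :
    ∀ v, g.op v = decide (∀ a, v a = true) := by
  obtain ⟨k', op, args⟩ := g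
  simp only [Gate.fn, GateFn.and, Sigma.mk.inj_iff] at h
  obtain ⟨rfl, hop⟩ := h
  cases hop
  exact fun v => rfl

/-- A `MAJₖ` gate computes `[k ≤ 2 · #ones]` of its arguments, `k` its arity. -/
theorem op_of_fn_eq_maj (g : Gate (Fin n)) {k : ℕ} (h : g.fn = GateFn.maj k) :
    ∀ v, g.op v = decide (g.arity ≤ 2 * GateFn.numOnes v) := by
  obtain ⟨k', op, args⟩ := g
  simp only [Gate.fn, GateFn.maj, Sigma.mk.inj_iff] at h
  obtain ⟨rfl, hop⟩ := h
  cases hop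
  exact fun v => rfl

/-- **The top gate.** A gate of `tcBasis` other than `¬` whose (valid) argument wires all carry
integer tests computes a function in normal form with `s + n` tests: an `OR` of the tests for `∨ₖ`,
the negation of the `OR` of the negated tests for `∧ₖ` (De Morgan), and a majority of the tests with
multiplicities for `MAJₖ`. -/
theorem nf_gate {s : ℕ} (g : Gate (Fin n)) (hg : g.fn ∈ tcBasis) (hne : g.fn ≠ GateFn.not)
    (val : (Fin n ⊕ ℕ) → (Fin n → Bool) → Bool) (hargs : ∀ a, OutOK s (g.args a))
    (hL : ∀ a, ∃ (w : Fin n → ℤ) (θ : ℤ), ∀ x : Fin n → Bool,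
      val (g.args a) x = decide (θ ≤ ∑ j, w j * (if x j then (1 : ℤ) else 0))) :
    ∃ (K : ℕ) (b : Bool) (w : Fin K → Fin n → ℤ) (t : Fin K → ℤ), K ≤ s + n ∧
      ((∀ x : Fin n → Bool, g.op (fun a => val (g.args a) x) = xor b (decide (∃ a : Fin K,
          t a ≤ ∑ i, w a i * (if x i then (1 : ℤ) else 0)))) ∨
       (∃ (μ : Fin K → ℕ) (θ : ℕ), ∀ x : Fin n → Bool,
          g.op (fun a => val (g.args a) x) = xor b (decide (θ ≤ 2 * ∑ a : Fin K,
            μ a * (decide (t a ≤ ∑ i, w a i * (if x i then (1 : ℤ) else 0))).toNat)))) := by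
  rcases (mem_tcBasis_iff g.fn).1 hg with h | ⟨k, h | h | h⟩
  · exact absurd h hne
  · -- `∧ₖ`: by De Morgan, the negation of the `OR` of the negated (integer) tests
    obtain ⟨w, t, hw⟩ := or_tests (fun u x => !val u x) g.args hargs
      (fun a => DepthOneLtf.ltf_not (hL a))
    refine ⟨s + n, true, w, t, le_rfl, Or.inl fun x => ?_⟩
    rw [op_of_fn_eq_and g h, xor_true_left, ← hw x, Bool.eq_iff_iff]
    simp
  · -- `∨ₖ`: the `OR` of the tests
    obtain ⟨w, t, hw⟩ := or_tests val g.args hargs hL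
    exact ⟨s + n, false, w, t, le_rfl, Or.inl fun x => by
      rw [op_of_fn_eq_or g h, xor_false_left, hw x]⟩
  · -- `MAJₖ`: `[k ≤ 2 · #ones]`, the ones counted over distinct wires with multiplicity
    obtain ⟨w, t, μ, hμ⟩ := numOnes_tests val g.args hargs hL
    exact ⟨s + n, false, w, t, le_rfl, Or.inr ⟨μ, g.arity, fun x => by
      rw [op_of_fn_eq_maj g h, xor_false_left, hμ x]⟩⟩

/-! ### The wire invariant -/

/-- **The depth-two wire invariant.** In a well-formed program over `tcBasis`, every valid wire of
`acWeight`-depth `≤ 2` carries a function in normal form with at most `#gates + n` tests. -/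
theorem wire_nf (gs : List (Gate (Fin n))) (hwf : WF gs) (hB : ∀ g ∈ gs, g.fn ∈ tcBasis)
    (u : Fin n ⊕ ℕ) (hu : OutOK gs.length u) (hd : wireDepthOf (wdepths acWeight gs) u ≤ 2) :
    ∃ (K : ℕ) (b : Bool) (w : Fin K → Fin n → ℤ) (t : Fin K → ℤ), K ≤ gs.length + n ∧
      ((∀ x : Fin n → Bool, wireOf x (vals gs x) u = xor b (decide (∃ a : Fin K,
          t a ≤ ∑ i, w a i * (if x i then (1 : ℤ) else 0)))) ∨
       (∃ (μ : Fin K → ℕ) (θ : ℕ), ∀ x : Fin n → Bool,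
          wireOf x (vals gs x) u = xor b (decide (θ ≤ 2 * ∑ a : Fin K,
            μ a * (decide (t a ≤ ∑ i, w a i * (if x i then (1 : ℤ) else 0))).toNat)))) := by
  induction gs using List.reverseRecOn generalizing u with
  | nil =>
    cases u with
    | inl i =>
      exact nf_of_ltf (by simp only [List.length_nil, Nat.zero_add]; exact Fin.pos i)
        (by simpa only [wireOf_inl] using DepthOneLtf.ltf_input i)
    | inr m => exact absurd (hu m rfl) (Nat.not_lt_zero m)
  | append_singleton gs g ih =>
    have hwf' : WF gs := hwf.of_append_left
    have hB' : ∀ g' ∈ gs, g'.fn ∈ tcBasis := fun g' hg' => hB g' (List.mem_append_left _ hg')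
    have hgB : g.fn ∈ tcBasis := hB g (List.mem_append_right _ (List.mem_singleton_self g))
    have hOK : GateOK gs.length g := hwf.getLast
    have hargs : ∀ a, OutOK gs.length (g.args a) := fun a m h => hOK a m h
    have hlen : gs.length + n ≤ (gs ++ [g]).length + n := by
      simp only [List.length_append, List.length_singleton]; omega
    cases u with
    | inl i =>
      exact nf_of_ltf (by simp only [List.length_append, List.length_singleton]; omega)
        (by simpa only [wireOf_inl] using DepthOneLtf.ltf_input i)
    | inr m =>
      have hm : m < gs.length + 1 := by simpa using hu m rfl
      rcases Nat.lt_succ_iff_lt_or_eq.1 hm with hlt | rfl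
      · -- a gate of the prefix: values and depths are unchanged
        have hu' : OutOK gs.length (.inr m : Fin n ⊕ ℕ) := fun m' h => by cases h; exact hlt
        have hval : ∀ x, wireOf x (vals (gs ++ [g]) x) (.inr m) = wireOf x (vals gs x) (.inr m) :=
          fun x => wireOf_vals_append gs [g] x _ hu'
        have hdep : wireDepthOf (wdepths acWeight (gs ++ [g])) (.inr m : Fin n ⊕ ℕ) =
            wireDepthOf (wdepths acWeight gs) (.inr m) :=
          wireDepthOf_wdepths_append acWeight gs [g] _ hu'
        rw [hdep] at hd
        simp only [hval]
        obtain ⟨K, b, w, t, hK, h⟩ := ih hwf' hB' _ hu' hd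
        exact ⟨K, b, w, t, hK.trans hlen, h⟩
      · -- the new gate
        have hval : ∀ x, wireOf x (vals (gs ++ [g]) x) (.inr gs.length) =
            g.op (fun a => wireOf x (vals gs x) (g.args a)) :=
          fun x => by rw [wireOf_inr, getD_vals_append_singleton]
        have hdep : wireDepthOf (wdepths acWeight (gs ++ [g])) (.inr gs.length : Fin n ⊕ ℕ) =
            acWeight g.fn + univ.sup fun a => wireDepthOf (wdepths acWeight gs) (g.args a) := by
          rw [wireDepthOf_inr, getD_wdepths_append_singleton]
        have hle : ∀ a, wireDepthOf (wdepths acWeight gs) (g.args a) ≤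
            univ.sup fun a => wireDepthOf (wdepths acWeight gs) (g.args a) := fun a =>
          Finset.le_sup (f := fun a => wireDepthOf (wdepths acWeight gs) (g.args a)) (mem_univ a)
        rw [hdep] at hd
        simp only [hval]
        by_cases hnot : g.fn = GateFn.not
        · -- a `¬` gate on a wire of depth `≤ 2`: flip the sign
          obtain ⟨a₀, hop⟩ := DepthOneLtf.op_eq_not_of_fn_eq_not g hnot
          have ha0 : wireDepthOf (wdepths acWeight gs) (g.args a₀) ≤ 2 := by
            have := hle a₀
            omega
          simp only [hop]
          obtain ⟨K, b, w, t, hK, h⟩ := nf_not (ih hwf' hB' (g.args a₀) (hargs a₀) ha0)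
          exact ⟨K, b, w, t, hK.trans hlen, h⟩
        · -- a gate `∧ₖ / ∨ₖ / MAJₖ` (weight `1`) on wires of depth `≤ 1`, i.e. on integer tests
          have hw1 : acWeight g.fn = 1 := by simp [acWeight, hnot]
          have hd1 : ∀ a, wireDepthOf (wdepths acWeight gs) (g.args a) ≤ 1 := by
            intro a
            have := hle a
            omega
          obtain ⟨K, b, w, t, hK, h⟩ := nf_gate g hgB hnot (fun u x => wireOf x (vals gs x) u) hargs
            (fun a => (DepthOneLtf.wire_invariant gs hwf' hB' (g.args a) (hargs a)).2 (hd1 a))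
          exact ⟨K, b, w, t, hK.trans hlen, h⟩

end DepthTwoNf

/-- **Stub `stub_depthTwo_nf` (line `Sketch`, v6; crux `LiouvilleOrthogonalTC0`) — the depth-two
normal form.** A circuit over `tcBasis` with `acDepth ≤ 2` computes, up to a free negation `b`,
either an `OR` of `K ≤ size + n` integer linear threshold tests of the inputs (top gate `∨ₖ`; top
gate `∧ₖ` by De Morgan, the negation of an integer test being one; or the whole circuit of depth
`≤ 1`, a single test), or a MAJORITY with multiplicities of `K ≤ size + n` such tests (top gate
`MAJₖ`: `[k ≤ 2·#ones]`, the distinct argument wires — inputs or earlier gates, each of `acDepth ≤ 1`,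
hence an integer test by `DepthOneLtf.wire_invariant` — counted with multiplicity). The `K` tests are
indexed by the distinct wires of the program (`size` gates and `n` inputs), whence `K ≤ size + n`. -/
theorem stub_depthTwo_nf {n : ℕ} (C : Circuit (Fin n)) (hB : C.IsOver tcBasis) (hd : C.acDepth ≤ 2) :
    ∃ (K : ℕ) (b : Bool) (w : Fin K → Fin n → ℤ) (t : Fin K → ℤ), K ≤ C.size + n ∧
      ((∀ x : Fin n → Bool, C.eval x = xor b (decide (∃ a : Fin K,
          t a ≤ ∑ i, w a i * (if x i then (1 : ℤ) else 0)))) ∨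
       (∃ (μ : Fin K → ℕ) (θ : ℕ), ∀ x : Fin n → Bool, C.eval x = xor b (decide (θ ≤ 2 * ∑ a : Fin K,
          μ a * (decide (t a ≤ ∑ i, w a i * (if x i then (1 : ℤ) else 0))).toNat)))) := by
  rw [Circuit.acDepth, circuit_depthWith] at hd
  obtain ⟨K, b, w, t, hK, h⟩ :=
    DepthTwoNf.wire_nf C.gates (wf_gates C) hB C.output C.wf_output hd
  refine ⟨K, b, w, t, hK, ?_⟩
  simp only [circuit_eval]
  exact h

end Summit.QuantumAdvantage.QuantumAdvantage.Theorems.LiouvilleOrthogonalTC0
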